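import Literature.MathematicalPhysics.QuantumFieldTheory.Balaban1983to89.B15Prop1LocalChartAtBaseField
import Literature.MathematicalPhysics.QuantumFieldTheory.Balaban1983to89.Node00.CriticalOnFibre

/-!
# `Balaban1983to89.B15Prop1CritTransferOfGaugeRetraction` — [Balaban1985Variational] = «[15]», Thm 1 p. 279 («a unique critical orbit in the space (6)»),
# (4) p. 278 (the residual gauge group «u(y) = 1 for y ∈ 𝔅_k»), (16)–(18) p. 280 («we fix the axial gauge conditions Ax_k(𝔅_k, U₀) … The functional (5) is gauge
# invariant, hence it is enough to consider it on the space (18)»), Sect. F p. 300, Sect. G p. 305; [Balaban1985RegularSpaces] = «[6]», (1.19) p. 79 (`Ax_k`);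
# [Balaban1988Convergent] = «[III]», (2.10)–(2.12) p. 256:
# THE CRITICALITY TRANSFER `hcritT` OF THE N12 LOCAL MINIMISER CHART — Lagrange criticality ON A GAUGE SLICE (for a configuration on the fibre) ⟹ criticality of the
# Wilson action (5) along EVERY curve in the fibre `{Ū = Ū(Q′) on 𝔹}` (n07-e's `Node00.IsCritOnFibre` currency) — PROVED modulo ONE displayed, purely gauge-geometric letter
# `hπ` (a gauge RETRACTION of fibre curves into the slice chart, print's axial gauge (16)–(18))

Honest framing: statement-level skeleton of published theorems with citation tags; proofs where landed; nothing here is a claim about the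
Yang–Mills mass gap.  Cell `pub-ymgap`, HUMAN RULING D-0149 ∕ director-ym R399 (3a) (width seats), seat `pub-ymgap-dag-n12-w6` (g0; N12 = [B15]); lane word dag-n12-c g17
«n12-w6 take hcritT-transfer» (cell bus 2026-08-28); `--kind proof --supports stmt-QuantumFields-20542 --as helper`; count-neutral; N12 NOT discharged; finite 𝕋⁴ at fixed ε;
nothing continuum ∕ ℝ⁴ ∕ OS ∕ mass-gap ∕ Clay.

WHY.  dag-n12-w1's local holomorphic minimiser chart at one base field (`B15Prop1LocalChartAtBaseField.exists_localChart_at_baseField`, consumed by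
`B15Prop1MinimiserFamilyAtRecord.hMin_of_baseFieldLetters`) leaves the per-base-field letter `hcritT` DISPLAYED: for slice points `w.1 ∈ S` near `0` whose chart image
`U′ = exp(w.1)·U₀` lies on the fibre of a datum `Q′` near the base datum `Q₀`, LAGRANGE criticality in the slice coordinates, `D a(w.1) = μ ∘ D Φ₀(w.1)`, must yield the
criticality predicate `Crit Q′ U′` that [15] Thm 1's uniqueness clause (`hT1u`) converts into minimality.  The predicate `Crit` is a PARAMETER there; the honest currency —
the one print's Prop. 8 ∕ Sect. F consume («critical configurations of the functional (5)», p. 300) and n07-e typed at NODE 00 as `Node00.IsCritOnFibre` — is CURVE-CRITICALITY: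
along every curve `γ` through `U′`, differentiable at `0` as a curve of bond matrices and lying in the fibre for small times, every derivative of `t ↦ A(γ t)` at `0` vanishes.
Print passes between the two by GAUGE FIXING ((16)–(18) p. 280: every configuration of (6) is moved into the axial gauge `Ax_k(𝔅_k, U₀)` by a residual gauge transformation (4),
which preserves the action (5) and the fibre (3)).  THIS FILE proves the transfer once and for all MODULO exactly that gauge-geometric step, displayed as the letter `hπ`
(«every fibre curve through `U′` is carried, with the same action and still on the fibre, by a curve `X` in the slice, differentiable at `0`, `X 0 = w.1`») — the calculus
(chain rule, the constancy of the constraint coordinates along the retracted curve, the reality of the complex action on `SU(2)` data) is discharged here; `hπ` carries NO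
derivative of the action and is the natural output of the `𝐁`-adapted axial gauge fixing (dag-n12-w3's `hierAxial` slice neighbourhood — its discharge venue, not re-derived here).

CONTENTS (theorems only; no `def`, no `instance`, no `sorry`).
* §1 CALCULUS CORE (generic normed spaces over `ℂ`, Mathlib only): `hasDerivAt_comp_eq_zero_of_lagrange` — Lagrange criticality `fderiv ℂ a (X 0) = μ.comp (fderiv ℂ Φ (X 0))`
  at a point of `ℂ`-differentiability of `a`, `Φ`, and a real curve `X` differentiable at `0` along which `Φ` is eventually constant ⟹ `HasDerivAt (a ∘ X) 0 0`;
  `deriv_eq_zero_of_ofReal_eventuallyEq` — a real function that agrees near `0` (through `ℝ → ℂ`) with such an `a ∘ X` has only the derivative `0` at `0`.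
* §2 THE N12 JUNCTION, generic torus `P`, averaging `av := exp-mean-log block averaging` (= NODE 00's `avOfRecord F 2 Kt` by `rfl`): `datumCoord_eq_of_agreeOn` (two `SU(2)` fields
  guarded below `k` with the same averages on `𝔹` have the same logarithmic datum coordinates `κ`), `action_eq_ofReal_wilsonAction4_of_expMulC_eq` (on a chart point that is an
  `SU(2)` field the complex action IS the Wilson action), ★★★ `hcritT_curve_of_gaugeRetraction` — w1's `hcritT` binder (`exists_localChart_at_baseField` :114–:117) VERBATIM at
  `Crit Q′ U′ :=` curve-criticality on the fibre of `avgFamily av Q′`, from the base-field data (guards, `U₀` on the base fibre, slice `S`, action `a`, coordinates `Φ₀`, all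
  characterised pointwise as in w1) and the displayed retraction letter `hπ`.
* §3 THE RECORD TWIN: ★★ `hcritT_isCritOnFibre_of_gaugeRetraction` — the same on the torus `F.P Kt` of the family with conclusion `Node00.IsCritOnFibre F 2 Kt 𝔹 (avgFamily (avOfRecord F 2 Kt) Q′) U′`
  (n07-e's predicate BY NAME; `avOfRecord F 2 Kt = av` by `rfl`); it applies verbatim to N12's determining sets `𝔹 := Bj ν.M₁ Z k` of [III] (2.13) (no support hypothesis is needed here).

NON-VACUITY ∕ LOCATED (A6 rule).  `hπ` is inhabited degenerately at the full slice `S = ⊤` (retract nothing: `V t := γ t`, `X t :=` the logarithmic chart of `γ t · U₀⁻¹`,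
`B15SU2ChartHolomorphic.expPointC_logCoordC`), and honestly — on a slice transversal to the residual gauge orbits — by the axial gauge of [6] (1.19) ∕ [15] (16)–(18) (explicit tree
recursion `u(x′) = U₀(b)⁻¹u(x)U(b)`, gauge invariance of (5) = r11's `B14Eq16FaddeevPopov.wilsonAction4_gaugeAct'`, covariance of the averaging = `Setup.Averaging.covariant`); that
discharge is dag-n12-w3's `hierAxial` venue and is NOT typed here.  With `S = ⊤` the companion letter (β) of the chart fails (gauge degeneracy), so the consumer's slice is a genuine
gauge slice — exactly where `hπ` has content.

HONEST FRAMING: a calculus junction; nothing of Bałaban's asserted; the letters (E) (existence of the base minimiser, [15] Thm 1 ∕ Prop. 7) and `hT1u` ([15] Thm 1's uniqueness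
clause) stay displayed in the lane; N12 NOT discharged; K1⁷ NOT closed; counts unmoved; one finite 𝕋⁴ programme at fixed ε — NOT continuum ∕ ℝ⁴ ∕ OS ∕ mass gap ∕ Clay.
-/

noncomputable section

namespace Literature.MathematicalPhysics.QuantumFieldTheory.Balaban1983to89.B15Prop1CritTransferOfGaugeRetraction

open Set Metric Filter
open scoped Topology
open Literature.MathematicalPhysics.QuantumFieldTheory.Balaban1983to89.Node00 (SU coeField coeField_apply SmallBelow ConstrSet constrCard constrEnum IsCritOnFibre
  avOfRecord)
open B15AveragingHolomorphic (iterMh)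
open B15SU2ChartHolomorphic (expMulC logCoordC)
open B15Prop1StateChartSU2 (analyticAt_expMulC_right)
open B15Prop1DatumCoordinates (eventually_smallBelow star_coe_mul_iterMh_coeField eventually_analyticAt_datumCoord expMulC_zero_left)
open B15Prop1ComplexWilsonAction (analyticAt_actionSum_expMulC)
open B15Prop1JointHolomorphyFromBackground (ofReal_wilsonAction4)
open ExpMeanLog (expMeanLogSU)
open BlockAveraging (blockAvg)
open T4CubeChartGnomonic (SU2)
open T4Continuum B15DeterminingSets GaugeField
open scoped Matrix.Norms.L2Operator

/-! ## §1  The calculus core: Lagrange criticality + a curve along which the constraint is constant -/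

section Core

variable {E F : Type*} [NormedAddCommGroup E] [NormedSpace ℂ E] [NormedAddCommGroup F] [NormedSpace ℂ F]

/-- **LAGRANGE CRITICALITY KILLS EVERY CURVE ALONG WHICH THE CONSTRAINT IS CONSTANT.**  If `a` and `Φ` are `ℂ`-differentiable at `X 0`, `D a(X 0) = μ ∘ D Φ(X 0)` (Lagrange
criticality in coordinates, the `hcrit`∕`hcritT` currency of the N12 chart), and `X : ℝ → E` is differentiable at `0` with `Φ ∘ X` eventually constant, then `(a ∘ X)′(0) = 0`
(chain rule: `(Φ ∘ X)′(0) = D Φ(X 0)·X′(0) = 0`, so `(a ∘ X)′(0) = μ(D Φ(X 0)·X′(0)) = 0`). [cite: Balaban1985Variational, Sect. F p.300 («critical configurations of the functional (5)»); LuenbergerYe2008, §11.3 p.327 (first-order necessary conditions)] -/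
theorem hasDerivAt_comp_eq_zero_of_lagrange {a : E → ℂ} {Φ : E → F} {μ : F →L[ℂ] ℂ} {X : ℝ → E}
    (hX : DifferentiableAt ℝ X 0) (ha : DifferentiableAt ℂ a (X 0)) (hΦ : DifferentiableAt ℂ Φ (X 0))
    (hlag : fderiv ℂ a (X 0) = μ.comp (fderiv ℂ Φ (X 0)))
    (hconst : ∀ᶠ t in 𝓝 (0 : ℝ), Φ (X t) = Φ (X 0)) :
    HasDerivAt (fun t => a (X t)) 0 0 := by
  have hXd : HasDerivAt X (deriv X 0) 0 := hX.hasDerivAt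
  have hΦX : HasDerivAt (fun t => Φ (X t)) ((fderiv ℂ Φ (X 0)).restrictScalars ℝ (deriv X 0)) 0 :=
    (hΦ.hasFDerivAt.restrictScalars ℝ).comp_hasDerivAt (x := (0 : ℝ)) hXd
  have hΦX0 : HasDerivAt (fun t => Φ (X t)) 0 0 := by
    have hc : (fun t => Φ (X t)) =ᶠ[𝓝 0] fun _ => Φ (X 0) := hconst
    exact (hasDerivAt_const (0 : ℝ) (Φ (X 0))).congr_of_eventuallyEq hc
  have hzero : fderiv ℂ Φ (X 0) (deriv X 0) = 0 := by
    have := hΦX.unique hΦX0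
    simpa using this
  have haX : HasDerivAt (fun t => a (X t)) ((fderiv ℂ a (X 0)).restrictScalars ℝ (deriv X 0)) 0 :=
    (ha.hasFDerivAt.restrictScalars ℝ).comp_hasDerivAt (x := (0 : ℝ)) hXd
  have hval : (fderiv ℂ a (X 0)).restrictScalars ℝ (deriv X 0) = 0 := by
    rw [ContinuousLinearMap.coe_restrictScalars', hlag, ContinuousLinearMap.comp_apply, hzero, map_zero]
  rwa [hval] at haX

omit [NormedAddCommGroup E] [NormedSpace ℂ E] in
/-- **REAL CONSEQUENCE**: a real function of `t` that coincides near `0`, through `ℝ → ℂ`, with a complex function having derivative `0` at `0` has only the derivative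
`0` at `0` (uniqueness of the derivative of `t ↦ ↑(f t)`). [cite: Balaban1985Variational, Sect. F p.300 (bookkeeping)] -/
theorem deriv_eq_zero_of_ofReal_eventuallyEq {E' : Type*} {a : E' → ℂ} {X : ℝ → E'} {f : ℝ → ℝ}
    (h : HasDerivAt (fun t => a (X t)) 0 0) (hf : ∀ᶠ t in 𝓝 (0 : ℝ), ((f t : ℝ) : ℂ) = a (X t))
    {d : ℝ} (hd : HasDerivAt f d 0) : d = 0 := by
  have h1 : HasDerivAt (fun t => ((f t : ℝ) : ℂ)) (d : ℂ) 0 := hd.ofReal_comp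
  have h2 : HasDerivAt (fun t => ((f t : ℝ) : ℂ)) 0 0 := h.congr_of_eventuallyEq hf
  exact_mod_cast h1.unique h2

end Core

/-! ## §2  The N12 junction: `hcritT` at curve-criticality, modulo a gauge retraction -/

section Junction

variable {P : Params}

/-- **TWO GUARDED FIELDS WITH THE SAME AVERAGES ON `𝔹` HAVE THE SAME LOGARITHMIC DATUM COORDINATES** (`κ Q i = log(W_j(c)⋆·Ū^j(Q)(c))` over the constrained bonds of levels
`≤ k`; under the guard the holomorphic iterate is the averaging of record, w1's `star_coe_mul_iterMh_coeField`).  In particular every field on the fibre of `Q′` (guarded) has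
the coordinates of `Q′`. [cite: Balaban1988Convergent, (2.10)–(2.11) p.256; Balaban1985Variational, Sect. G p.305 («B = (1∕i) log V»)] -/
theorem datumCoord_eq_of_agreeOn (𝔹 : DetSet P) (k : ℕ) (W : MSField P SU2)
    (κ : (PBond P 0 → Matrix (Fin 2) (Fin 2) ℂ) → Fin (constrCard 𝔹 k) → EuclideanSpace ℂ (Fin 3))
    (hκ : ∀ Q i, κ Q i = logCoordC (star ((W ((constrEnum 𝔹 k).symm i).1 ((constrEnum 𝔹 k).symm i).2.1 : SU2) : Matrix (Fin 2) (Fin 2) ℂ) *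
      iterMh ((constrEnum 𝔹 k).symm i).1 Q ((constrEnum 𝔹 k).symm i).2.1))
    {U V : GaugeField P 0 SU2}
    (hsbU : SmallBelow (fun j => blockAvg (P := P) (j := j) expMeanLogSU) k U)
    (hsbV : SmallBelow (fun j => blockAvg (P := P) (j := j) expMeanLogSU) k V)
    (h : AgreeOn 𝔹 (avgFamily (fun j => blockAvg (P := P) (j := j) expMeanLogSU) U) (avgFamily (fun j => blockAvg (P := P) (j := j) expMeanLogSU) V)) :
    κ (coeField U) = κ (coeField V) := by
  funext i
  have hj : (((constrEnum 𝔹 k).symm i).1 : ℕ) ≤ k := Nat.lt_succ_iff.1 ((constrEnum 𝔹 k).symm i).1.2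
  rw [hκ, hκ, star_coe_mul_iterMh_coeField k W hsbU hj, star_coe_mul_iterMh_coeField k W hsbV hj,
    h _ _ ((constrEnum 𝔹 k).symm i).2.2]

/-- **ON A CHART POINT THAT IS AN `SU(2)` FIELD THE COMPLEX ACTION IS THE WILSON ACTION (5)**: if `exp(X)·U₀ = ↑V` then `a X = ↑A(V)` (w1's pointwise characterisation of `a`
and n12-c's trace formula `ofReal_wilsonAction4`). [cite: Balaban1985Variational, (5) p.278, Sect. G p.305; Balaban1987RG1, (0.2) p.252] -/
theorem action_eq_ofReal_wilsonAction4_of_expMulC_eq (U₀ : GaugeField P 0 SU2) (S : Submodule ℂ (VecField P 0 (EuclideanSpace ℂ (Fin 3)))) (a : S → ℂ)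
    (ha : ∀ X : S, a X = ∑ p : Plaq P 0, (1 - (expMulC (X : VecField P 0 (EuclideanSpace ℂ (Fin 3))) (coeField U₀) ⟨p.src, p.μ⟩ *
      expMulC (X : VecField P 0 (EuclideanSpace ℂ (Fin 3))) (coeField U₀) ⟨p.src.shift p.μ, p.ν⟩ *
      Matrix.adjugate (expMulC (X : VecField P 0 (EuclideanSpace ℂ (Fin 3))) (coeField U₀) ⟨p.src.shift p.ν, p.μ⟩) *
      Matrix.adjugate (expMulC (X : VecField P 0 (EuclideanSpace ℂ (Fin 3))) (coeField U₀) ⟨p.src, p.ν⟩)).trace / 2))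
    {X : S} {V : GaugeField P 0 SU2} (hXV : expMulC (X : VecField P 0 (EuclideanSpace ℂ (Fin 3))) (coeField U₀) = coeField V) :
    a X = ((wilsonAction4 V : ℝ) : ℂ) := by
  rw [ha, hXV, ofReal_wilsonAction4]
  rfl

/-- ★★★ **THE CRITICALITY TRANSFER `hcritT` AT CURVE-CRITICALITY, MODULO A GAUGE RETRACTION.**  Data as in w1's `exists_localChart_at_baseField` (one base field): a real datum
`Q₀` and a configuration `U₀` ON ITS FIBRE, both guarded below `k`; a slice `S ≤ (PBond P 0 → ℂ³)`; the complex action `a` and the logarithmic datum coordinates `Φ₀` on the slice,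
characterised pointwise.  DISPLAYED: the gauge retraction `hπ` — near `(0, ↑Q₀)`, for a slice point `w.1` whose chart image `U′` lies on the fibre of `Q′` (`↑Q′ = w.2`), every
curve `γ` through `U′`, differentiable at `0` as bond matrices and eventually on that fibre, is carried by a curve `X : ℝ → S`, differentiable at `0`, `X 0 = w.1`, whose chart
images are, for small times, `SU(2)` fields `V t` with THE SAME ACTION as `γ t` and still on the fibre (print: the residual-gauge move into `Ax_k(𝔅_k, U₀)`, (16)–(18), with the
invariance of (5) and of (3)).  CONCLUSION — the `hcritT` binder of `exists_localChart_at_baseField` with `Crit Q′ U′ :=` «every fibre curve through `U′` is critical for the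
Wilson action» (n07-e's `Node00.IsCritOnFibre` currency): LAGRANGE criticality on the slice ⟹ CURVE criticality on the fibre. [cite: Balaban1985Variational, Thm 1 p.279, (4) p.278, (16)–(18) p.280, Sect. F p.300, Sect. G p.305; Balaban1985RegularSpaces, (1.19) p.79; Balaban1988Convergent, (2.10)–(2.12) p.256] -/
theorem hcritT_curve_of_gaugeRetraction (𝔹 : DetSet P) (k : ℕ) {Q₀ U₀ : GaugeField P 0 SU2}
    (hsbQ : SmallBelow (fun j => blockAvg (P := P) (j := j) expMeanLogSU) k Q₀)
    (hsbU : SmallBelow (fun j => blockAvg (P := P) (j := j) expMeanLogSU) k U₀)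
    (hU₀ : AgreeOn 𝔹 (avgFamily (fun j => blockAvg (P := P) (j := j) expMeanLogSU) U₀) (avgFamily (fun j => blockAvg (P := P) (j := j) expMeanLogSU) Q₀))
    -- the gauge slice
    (S : Submodule ℂ (VecField P 0 (EuclideanSpace ℂ (Fin 3))))
    -- the action and the constraint coordinates on the slice, characterised pointwise
    (a : S → ℂ)
    (ha : ∀ X : S, a X = ∑ p : Plaq P 0, (1 - (expMulC (X : VecField P 0 (EuclideanSpace ℂ (Fin 3))) (coeField U₀) ⟨p.src, p.μ⟩ *
      expMulC (X : VecField P 0 (EuclideanSpace ℂ (Fin 3))) (coeField U₀) ⟨p.src.shift p.μ, p.ν⟩ *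
      Matrix.adjugate (expMulC (X : VecField P 0 (EuclideanSpace ℂ (Fin 3))) (coeField U₀) ⟨p.src.shift p.ν, p.μ⟩) *
      Matrix.adjugate (expMulC (X : VecField P 0 (EuclideanSpace ℂ (Fin 3))) (coeField U₀) ⟨p.src, p.ν⟩)).trace / 2))
    (Φ₀ : S → Fin (constrCard 𝔹 k) → EuclideanSpace ℂ (Fin 3))
    (hΦ₀ : ∀ (X : S) i, Φ₀ X i = logCoordC (star ((avgFamily (fun j => blockAvg (P := P) (j := j) expMeanLogSU) Q₀ ((constrEnum 𝔹 k).symm i).1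
      ((constrEnum 𝔹 k).symm i).2.1 : SU2) : Matrix (Fin 2) (Fin 2) ℂ) *
      iterMh ((constrEnum 𝔹 k).symm i).1 (expMulC (X : VecField P 0 (EuclideanSpace ℂ (Fin 3))) (coeField U₀)) ((constrEnum 𝔹 k).symm i).2.1))
    -- DISPLAYED: the gauge retraction of fibre curves into the slice chart ([15] (16)–(18): axial gauge by the residual group (4))
    (hπ : ∀ᶠ w in 𝓝 ((0 : S), coeField Q₀), ∀ U' Q' : GaugeField P 0 SU2,
      expMulC (w.1 : VecField P 0 (EuclideanSpace ℂ (Fin 3))) (coeField U₀) = coeField U' → coeField Q' = w.2 →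
        AgreeOn 𝔹 (avgFamily (fun j => blockAvg (P := P) (j := j) expMeanLogSU) U') (avgFamily (fun j => blockAvg (P := P) (j := j) expMeanLogSU) Q') →
        ∀ γ : ℝ → GaugeField P 0 SU2, γ 0 = U' →
          DifferentiableAt ℝ (fun (t : ℝ) (b : PBond P 0) => ((γ t b : SU2) : Matrix (Fin 2) (Fin 2) ℂ)) 0 →
          (∀ᶠ t in 𝓝 (0 : ℝ), AgreeOn 𝔹 (avgFamily (fun j => blockAvg (P := P) (j := j) expMeanLogSU) (γ t))
            (avgFamily (fun j => blockAvg (P := P) (j := j) expMeanLogSU) Q')) →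
          ∃ X : ℝ → S, X 0 = w.1 ∧ DifferentiableAt ℝ X 0 ∧
            ∀ᶠ t in 𝓝 (0 : ℝ), ∃ V : GaugeField P 0 SU2,
              expMulC (X t : VecField P 0 (EuclideanSpace ℂ (Fin 3))) (coeField U₀) = coeField V ∧
              wilsonAction4 V = wilsonAction4 (γ t) ∧
              AgreeOn 𝔹 (avgFamily (fun j => blockAvg (P := P) (j := j) expMeanLogSU) V) (avgFamily (fun j => blockAvg (P := P) (j := j) expMeanLogSU) Q')) :
    ∀ᶠ w in 𝓝 ((0 : S), coeField Q₀), ∀ (U' Q' : GaugeField P 0 SU2) (μ : (Fin (constrCard 𝔹 k) → EuclideanSpace ℂ (Fin 3)) →L[ℂ] ℂ),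
      expMulC (w.1 : VecField P 0 (EuclideanSpace ℂ (Fin 3))) (coeField U₀) = coeField U' → coeField Q' = w.2 →
        AgreeOn 𝔹 (avgFamily (fun j => blockAvg (P := P) (j := j) expMeanLogSU) U') (avgFamily (fun j => blockAvg (P := P) (j := j) expMeanLogSU) Q') →
        fderiv ℂ a w.1 = μ.comp (fderiv ℂ Φ₀ w.1) →
          ∀ γ : ℝ → GaugeField P 0 SU2, γ 0 = U' →
            DifferentiableAt ℝ (fun (t : ℝ) (b : PBond P 0) => ((γ t b : SU2) : Matrix (Fin 2) (Fin 2) ℂ)) 0 →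
            (∀ᶠ t in 𝓝 (0 : ℝ), AgreeOn 𝔹 (avgFamily (fun j => blockAvg (P := P) (j := j) expMeanLogSU) (γ t))
              (avgFamily (fun j => blockAvg (P := P) (j := j) expMeanLogSU) Q')) →
            ∀ d : ℝ, HasDerivAt (fun t => wilsonAction4 (γ t)) d 0 → d = 0 := by
  -- abbreviations
  set av : ∀ j, Averaging P j SU2 := fun j => blockAvg (P := P) (j := j) expMeanLogSU with hav
  set W : MSField P SU2 := avgFamily av Q₀ with hW
  -- the datum coordinates `κ` (pointwise), the state chart `χ`
  set κ : (PBond P 0 → Matrix (Fin 2) (Fin 2) ℂ) → Fin (constrCard 𝔹 k) → EuclideanSpace ℂ (Fin 3) := fun Q i =>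
    logCoordC (star ((W ((constrEnum 𝔹 k).symm i).1 ((constrEnum 𝔹 k).symm i).2.1 : SU2) : Matrix (Fin 2) (Fin 2) ℂ) *
      iterMh ((constrEnum 𝔹 k).symm i).1 Q ((constrEnum 𝔹 k).symm i).2.1) with hκdef
  have hκ : ∀ Q i, κ Q i = logCoordC (star ((W ((constrEnum 𝔹 k).symm i).1 ((constrEnum 𝔹 k).symm i).2.1 : SU2) : Matrix (Fin 2) (Fin 2) ℂ) *
      iterMh ((constrEnum 𝔹 k).symm i).1 Q ((constrEnum 𝔹 k).symm i).2.1) := fun Q i => rfl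
  set χ : S → PBond P 0 → Matrix (Fin 2) (Fin 2) ℂ := fun X => expMulC (X : VecField P 0 (EuclideanSpace ℂ (Fin 3))) (coeField U₀) with hχdef
  have hχ0 : χ 0 = coeField U₀ := by
    show expMulC ((0 : S) : VecField P 0 (EuclideanSpace ℂ (Fin 3))) (coeField U₀) = coeField U₀
    rw [Submodule.coe_zero, expMulC_zero_left]
  have hχan : ∀ X : S, AnalyticAt ℂ χ X := fun X =>
    (analyticAt_expMulC_right (coeField U₀) _).comp (S.subtypeL.analyticAt X)
  have hχt : Tendsto χ (𝓝 0) (𝓝 (coeField U₀)) := by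
    have h := (hχan 0).continuousAt.tendsto; rwa [hχ0] at h
  have hΦ₀κ : ∀ X : S, Φ₀ X = κ (χ X) := fun X => funext fun i => by rw [hΦ₀, hκ]
  -- analyticity of `a` everywhere
  have haan : ∀ X : S, AnalyticAt ℂ a X := fun X => by
    have hfun : a = fun X : S => ∑ p : Plaq P 0, (1 - (expMulC (X : VecField P 0 (EuclideanSpace ℂ (Fin 3))) (coeField U₀) ⟨p.src, p.μ⟩ *
        expMulC (X : VecField P 0 (EuclideanSpace ℂ (Fin 3))) (coeField U₀) ⟨p.src.shift p.μ, p.ν⟩ *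
        Matrix.adjugate (expMulC (X : VecField P 0 (EuclideanSpace ℂ (Fin 3))) (coeField U₀) ⟨p.src.shift p.ν, p.μ⟩) *
        Matrix.adjugate (expMulC (X : VecField P 0 (EuclideanSpace ℂ (Fin 3))) (coeField U₀) ⟨p.src, p.ν⟩)).trace / 2) := funext ha
    rw [hfun]
    exact (analyticAt_actionSum_expMulC (P := P) (j := 0) (A := fun W => ∑ p : Plaq P 0, (1 - (W ⟨p.src, p.μ⟩ * W ⟨p.src.shift p.μ, p.ν⟩ *
      Matrix.adjugate (W ⟨p.src.shift p.ν, p.μ⟩) * Matrix.adjugate (W ⟨p.src, p.ν⟩)).trace / 2)) (fun _ => rfl) U₀ _).comp (S.subtypeL.analyticAt X)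
  -- `κ` is analytic near `↑U₀` (the base state lies on the fibre of `W`), and the guard is open near `↑U₀` and near `↑Q₀`
  have hκan : ∀ᶠ Q in 𝓝 (coeField U₀), AnalyticAt ℂ κ Q := eventually_analyticAt_datumCoord 𝔹 k W κ hκ hsbU hU₀
  have hgU : ∀ᶠ Q in 𝓝 (coeField U₀), ∀ U : GaugeField P 0 SU2, coeField U = Q → SmallBelow av k U := eventually_smallBelow hsbU
  have hgQ : ∀ᶠ Q in 𝓝 (coeField Q₀), ∀ U : GaugeField P 0 SU2, coeField U = Q → SmallBelow av k U := eventually_smallBelow hsbQ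
  obtain ⟨O, hOsub, hOopen, hOmem⟩ := _root_.mem_nhds_iff.1 (hκan.and hgU)
  have hXO : ∀ᶠ X in 𝓝 (0 : S), χ X ∈ O := hχt (hOopen.mem_nhds hOmem)
  have h1 : ∀ᶠ w : S × (PBond P 0 → Matrix (Fin 2) (Fin 2) ℂ) in 𝓝 ((0 : S), coeField Q₀), χ w.1 ∈ O := hXO.prod_inl_nhds (coeField Q₀)
  have h2 : ∀ᶠ w : S × (PBond P 0 → Matrix (Fin 2) (Fin 2) ℂ) in 𝓝 ((0 : S), coeField Q₀),
      ∀ U : GaugeField P 0 SU2, coeField U = w.2 → SmallBelow av k U := hgQ.prod_inr_nhds (0 : S)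
  filter_upwards [h1, h2, hπ] with w hw1 hw2 hπw U' Q' μ hU' hQ' hagree hlag γ hγ0 hγd hγfib d hd
  -- the retracted curve in the slice
  obtain ⟨X, hX0, hXd, hXev⟩ := hπw U' Q' hU' hQ' hagree γ hγ0 hγd hγfib
  have hsbQ' : SmallBelow av k Q' := hw2 Q' hQ'
  have hX0O : χ (X 0) ∈ O := by rw [hX0]; exact hw1
  have hXtO : ∀ᶠ t in 𝓝 (0 : ℝ), χ (X t) ∈ O :=
    ((hχan (X 0)).continuousAt.tendsto.comp hXd.continuousAt) (hOopen.mem_nhds hX0O)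
  -- the constraint coordinates are constant along the retracted curve (every `V t` lies on the fibre of `Q′`)
  have hconst : ∀ᶠ t in 𝓝 (0 : ℝ), Φ₀ (X t) = κ (coeField Q') := by
    filter_upwards [hXev, hXtO] with t ht htO
    obtain ⟨V, hXV, -, hVfib⟩ := ht
    have hXV' : χ (X t) = coeField V := hXV
    have hsbV : SmallBelow av k V := (hOsub htO).2 V hXV'.symm
    rw [hΦ₀κ, hXV']
    exact datumCoord_eq_of_agreeOn 𝔹 k W κ hκ hsbV hsbQ' hVfib
  have hconst0 : ∀ᶠ t in 𝓝 (0 : ℝ), Φ₀ (X t) = Φ₀ (X 0) := by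
    have h0 : Φ₀ (X 0) = κ (coeField Q') := hconst.self_of_nhds
    filter_upwards [hconst] with t ht
    rw [ht, h0]
  -- differentiability at `X 0 = w.1` and the Lagrange identity there
  have haD : DifferentiableAt ℂ a (X 0) := (haan _).differentiableAt
  have hΦD : DifferentiableAt ℂ Φ₀ (X 0) := by
    have hfun : Φ₀ = fun X => κ (χ X) := funext hΦ₀κ
    rw [hfun]
    exact ((hOsub hX0O).1.comp (hχan _)).differentiableAt
  have hlag' : fderiv ℂ a (X 0) = μ.comp (fderiv ℂ Φ₀ (X 0)) := by rw [hX0]; exact hlag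
  have hcore : HasDerivAt (fun t => a (X t)) 0 0 := hasDerivAt_comp_eq_zero_of_lagrange hXd haD hΦD hlag' hconst0
  -- the action along `γ` is the (real part of the) complex action along the retracted curve
  have hact : ∀ᶠ t in 𝓝 (0 : ℝ), ((wilsonAction4 (γ t) : ℝ) : ℂ) = a (X t) := by
    filter_upwards [hXev] with t ht
    obtain ⟨V, hXV, hAV, -⟩ := ht
    rw [← hAV]
    exact (action_eq_ofReal_wilsonAction4_of_expMulC_eq U₀ S a ha hXV).symm
  exact deriv_eq_zero_of_ofReal_eventuallyEq hcore hact hd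

end Junction

/-! ## §3  The record twin: n07-e's `Node00.IsCritOnFibre` on the torus of the family -/

section Record

variable {F : T4Family}

/-- ★★ **THE RECORD TWIN** — on the finest torus of the `Kt`-th approximation, with NODE 00's averaging of record (`avOfRecord F 2 Kt` = the exp-mean-log block averaging, `rfl`):
the `hcritT` binder of the N12 chart at `Crit Q′ U′ := Node00.IsCritOnFibre F 2 Kt 𝔹 (avgFamily (avOfRecord F 2 Kt) Q′) U′` («`U′` is a critical configuration of (5) on the fibre
`𝔅(𝐁, Ū(Q′))`», n07-e's predicate BY NAME), from the base-field data and the displayed gauge retraction `hπ`.  Applies verbatim to `𝔹 := Bj ν.M₁ Z k` ([III] (2.13)), the determining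
sets of the [IV] Prop. 1 endpoint. [cite: Balaban1985Variational, Thm 1 p.279, (16)–(18) p.280, Prop. 8 p.304, Sect. F p.300; Balaban1988Convergent, (2.10)–(2.13) pp.256–257; Balaban1989LargeFieldI, Prop. 1 p.194] -/
theorem hcritT_isCritOnFibre_of_gaugeRetraction (Kt : ℕ) (𝔹 : DetSet (F.P Kt)) (k : ℕ) {Q₀ U₀ : GaugeField (F.P Kt) 0 SU2}
    (hsbQ : SmallBelow (fun j => blockAvg (P := F.P Kt) (j := j) expMeanLogSU) k Q₀)
    (hsbU : SmallBelow (fun j => blockAvg (P := F.P Kt) (j := j) expMeanLogSU) k U₀)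
    (hU₀ : AgreeOn 𝔹 (avgFamily (fun j => blockAvg (P := F.P Kt) (j := j) expMeanLogSU) U₀) (avgFamily (fun j => blockAvg (P := F.P Kt) (j := j) expMeanLogSU) Q₀))
    (S : Submodule ℂ (VecField (F.P Kt) 0 (EuclideanSpace ℂ (Fin 3))))
    (a : S → ℂ)
    (ha : ∀ X : S, a X = ∑ p : Plaq (F.P Kt) 0, (1 - (expMulC (X : VecField (F.P Kt) 0 (EuclideanSpace ℂ (Fin 3))) (coeField U₀) ⟨p.src, p.μ⟩ *
      expMulC (X : VecField (F.P Kt) 0 (EuclideanSpace ℂ (Fin 3))) (coeField U₀) ⟨p.src.shift p.μ, p.ν⟩ *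
      Matrix.adjugate (expMulC (X : VecField (F.P Kt) 0 (EuclideanSpace ℂ (Fin 3))) (coeField U₀) ⟨p.src.shift p.ν, p.μ⟩) *
      Matrix.adjugate (expMulC (X : VecField (F.P Kt) 0 (EuclideanSpace ℂ (Fin 3))) (coeField U₀) ⟨p.src, p.ν⟩)).trace / 2))
    (Φ₀ : S → Fin (constrCard 𝔹 k) → EuclideanSpace ℂ (Fin 3))
    (hΦ₀ : ∀ (X : S) i, Φ₀ X i = logCoordC (star ((avgFamily (fun j => blockAvg (P := F.P Kt) (j := j) expMeanLogSU) Q₀ ((constrEnum 𝔹 k).symm i).1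
      ((constrEnum 𝔹 k).symm i).2.1 : SU2) : Matrix (Fin 2) (Fin 2) ℂ) *
      iterMh ((constrEnum 𝔹 k).symm i).1 (expMulC (X : VecField (F.P Kt) 0 (EuclideanSpace ℂ (Fin 3))) (coeField U₀)) ((constrEnum 𝔹 k).symm i).2.1))
    (hπ : ∀ᶠ w in 𝓝 ((0 : S), coeField Q₀), ∀ U' Q' : GaugeField (F.P Kt) 0 SU2,
      expMulC (w.1 : VecField (F.P Kt) 0 (EuclideanSpace ℂ (Fin 3))) (coeField U₀) = coeField U' → coeField Q' = w.2 →
        AgreeOn 𝔹 (avgFamily (fun j => blockAvg (P := F.P Kt) (j := j) expMeanLogSU) U') (avgFamily (fun j => blockAvg (P := F.P Kt) (j := j) expMeanLogSU) Q') →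
        ∀ γ : ℝ → GaugeField (F.P Kt) 0 SU2, γ 0 = U' →
          DifferentiableAt ℝ (fun (t : ℝ) (b : PBond (F.P Kt) 0) => ((γ t b : SU2) : Matrix (Fin 2) (Fin 2) ℂ)) 0 →
          (∀ᶠ t in 𝓝 (0 : ℝ), AgreeOn 𝔹 (avgFamily (fun j => blockAvg (P := F.P Kt) (j := j) expMeanLogSU) (γ t))
            (avgFamily (fun j => blockAvg (P := F.P Kt) (j := j) expMeanLogSU) Q')) →
          ∃ X : ℝ → S, X 0 = w.1 ∧ DifferentiableAt ℝ X 0 ∧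
            ∀ᶠ t in 𝓝 (0 : ℝ), ∃ V : GaugeField (F.P Kt) 0 SU2,
              expMulC (X t : VecField (F.P Kt) 0 (EuclideanSpace ℂ (Fin 3))) (coeField U₀) = coeField V ∧
              wilsonAction4 V = wilsonAction4 (γ t) ∧
              AgreeOn 𝔹 (avgFamily (fun j => blockAvg (P := F.P Kt) (j := j) expMeanLogSU) V)
                (avgFamily (fun j => blockAvg (P := F.P Kt) (j := j) expMeanLogSU) Q')) :
    ∀ᶠ w in 𝓝 ((0 : S), coeField Q₀), ∀ (U' Q' : GaugeField (F.P Kt) 0 SU2) (μ : (Fin (constrCard 𝔹 k) → EuclideanSpace ℂ (Fin 3)) →L[ℂ] ℂ),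
      expMulC (w.1 : VecField (F.P Kt) 0 (EuclideanSpace ℂ (Fin 3))) (coeField U₀) = coeField U' → coeField Q' = w.2 →
        AgreeOn 𝔹 (avgFamily (fun j => blockAvg (P := F.P Kt) (j := j) expMeanLogSU) U') (avgFamily (fun j => blockAvg (P := F.P Kt) (j := j) expMeanLogSU) Q') →
        fderiv ℂ a w.1 = μ.comp (fderiv ℂ Φ₀ w.1) →
          IsCritOnFibre F 2 Kt 𝔹 (avgFamily (avOfRecord F 2 Kt) Q') U' := by
  filter_upwards [hcritT_curve_of_gaugeRetraction 𝔹 k hsbQ hsbU hU₀ S a ha Φ₀ hΦ₀ hπ] with w hw U' Q' μ hU' hQ' hagree hlag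
  exact hw U' Q' μ hU' hQ' hagree hlag

end Record

end Literature.MathematicalPhysics.QuantumFieldTheory.Balaban1983to89.B15Prop1CritTransferOfGaugeRetraction

end
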